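import Literature.Topology.FourManifolds.BranchedDoubleQuotient
import Mathlib.Geometry.Manifold.LocalDiffeomorph
import Mathlib.Topology.Compactness.Compact
import HarnessLib

/-!
# The comparison homeomorphism between two branched double quotients by the same involution

Topic `Topology/FourManifolds`; namespace `Literature.Topology.FourManifolds`. First file of the
proof of the named fact `Literature.Topology.FourManifolds.DegtyarevKharlamov2000_conjQuotient_unique`
(`ConjugationQuotients.lean`: any two standard-model smoothings `q₁ : X → Y₁`, `q₂ : X → Y₂` of
the orbit space of an involution `σ` with codimension-`2` fixed set — `IsBranchedDoubleQuotient σ qᵢ`,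
`BranchedDoubleQuotient.lean` — have diffeomorphic targets; Degtyarev–Kharlamov, Russian Math.
Surveys 55 (2000), §3.2 ¶1: "up to isotopy, there is a unique smooth structure on `X/conj` such
that the projection `X → X/conj` is a double covering branched over `ℝX`").

This file contains the point-set and `C^∞`-away-from-the-branch-locus part. Everything is proved;
there are no named facts.

* `IsBranchedDoubleQuotient.preimage_image`: `q ⁻¹' (q '' U) = U ∪ σ ⁻¹' U`; hence `q` is an open
  map as soon as `σ` is continuous (`IsBranchedDoubleQuotient.isOpenMap`), `Y` is compact when `X`
  is (`IsBranchedDoubleQuotient.compactSpace`), and the branch locus `q '' Fix σ` is compact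
  (`IsBranchedDoubleQuotient.isCompact_image_fixedPoints`).
* `IsBranchedDoubleQuotient.comparison h₁ h₂ : Y₁ → Y₂` — **the comparison map** of two branched
  double quotients `q₁`, `q₂` of `X` by the same `σ`: the unique map with
  `comparison h₁ h₂ ∘ q₁ = q₂` (`comparison_apply`). It is an involutive pair of bijections
  (`comparison_comparison`), continuous (`continuous_comparison`, quotient topology), hence a
  homeomorphism `IsBranchedDoubleQuotient.comparisonHomeomorph : Y₁ ≃ₜ Y₂`.
* `IsBranchedDoubleQuotient.contMDiffAt_comparison`: at the image `q₁ x` of a NON-fixed point the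
  comparison map is `C^∞` — it agrees near `q₁ x` with `q₂ ∘ s` for the `C^∞` local inverse `s`
  of `q₁` at `x` — and is a `C^∞` local diffeomorphism there
  (`isLocalDiffeomorphAt_comparison`).

At branch points the comparison map is in general NOT differentiable (in adapted charts it reads
`(u, w) ↦ (θ₁(u, √w), θ₂(u, √w)²)` for the transition `θ` between the two adapted charts of `X`,
e.g. `w ↦ (A√w)²` for `θ = id × A`, `A = diag(1, 2)`); the diffeomorphism `Y₁ ≃ₘ Y₂` of the named
fact is built in the sequel files by modifying the comparison map near the branch locus.

## References

* A. Degtyarev, V. Kharlamov, *Topological properties of real algebraic varieties: du côté de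
  chez Rokhlin*, Russian Math. Surveys 55 (2000), arXiv:math/0004134, §3.2 ¶1.
  [DegtyarevKharlamov2000]
* S. Finashin, J. reine angew. Math. 481 (1996), arXiv:dg-ga/9506007, §1 ¶2. [Finashin1996]
-/

noncomputable section

open scoped Manifold ContDiff Topology
open Set Function

namespace Literature.Topology.FourManifolds


/-! ### Local diffeomorphisms: invariance under eventual equality -/

section Congr

variable {E₁ : Type*} [NormedAddCommGroup E₁] [NormedSpace ℝ E₁] {H₁ : Type*} [TopologicalSpace H₁]
  {I₁ : ModelWithCorners ℝ E₁ H₁} {E₂ : Type*} [NormedAddCommGroup E₂] [NormedSpace ℝ E₂]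
  {H₂ : Type*} [TopologicalSpace H₂] {I₂ : ModelWithCorners ℝ E₂ H₂}
  {M₁ : Type*} [TopologicalSpace M₁] [ChartedSpace H₁ M₁]
  {M₂ : Type*} [TopologicalSpace M₂] [ChartedSpace H₂ M₂] {n : WithTop ℕ∞}

/-- **A map which agrees near `x` with a local diffeomorphism at `x` is a local diffeomorphism at
`x`** (restrict the partial diffeomorphism to an open set on which the two maps agree).
[folklore] -/
theorem _root_.IsLocalDiffeomorphAt.congr_of_eventuallyEq {f g : M₁ → M₂} {x : M₁}
    (hf : IsLocalDiffeomorphAt I₁ I₂ n f x) (hfg : g =ᶠ[𝓝 x] f) :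
    IsLocalDiffeomorphAt I₁ I₂ n g x := by
  obtain ⟨Φ, hxΦ, heq⟩ := hf
  obtain ⟨U, hUnhds, hUeq⟩ := Filter.eventually_iff_exists_mem.1 hfg
  obtain ⟨V, hVU, hVopen, hxV⟩ := mem_nhds_iff.1 hUnhds
  let Ψ : PartialDiffeomorph I₁ I₂ M₁ M₂ n :=
    { toPartialEquiv := Φ.toPartialEquiv.restr V
      open_source := Φ.open_source.inter hVopen
      open_target := by
        rw [PartialEquiv.restr_target]
        exact Φ.toOpenPartialHomeomorph.symm.isOpen_inter_preimage hVopen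
      contMDiffOn_toFun := Φ.contMDiffOn_toFun.mono fun y hy => hy.1
      contMDiffOn_invFun := Φ.contMDiffOn_invFun.mono fun y hy => hy.1 }
  refine ⟨Ψ, ⟨hxΦ, hxV⟩, fun y hy => ?_⟩
  show g y = Φ y
  rw [hUeq y (hVU hy.2), heq hy.1]

end Congr

namespace IsBranchedDoubleQuotient

variable {X : Type*} [TopologicalSpace X] [ChartedSpace (Fin 2 → ℂ) X]
  {Y : Type*} [TopologicalSpace Y] [ChartedSpace (EuclideanSpace ℝ (Fin 4)) Y]
  {σ : X → X} {q : X → Y}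

/-! ### Point-set topology of one branched double quotient -/

/-- The saturation of a set: `q ⁻¹' (q '' U) = U ∪ σ ⁻¹' U` (the fibres of `q` are the
`σ`-orbits and `σ` is an involution). [folklore] -/
theorem preimage_image (h : IsBranchedDoubleQuotient σ q) (U : Set X) :
    q ⁻¹' (q '' U) = U ∪ σ ⁻¹' U := by
  ext x
  simp only [mem_preimage, mem_image, mem_union]
  constructor
  · rintro ⟨y, hyU, hyx⟩
    rcases (h.apply_eq_iff y x).1 hyx with rfl | rfl
    · exact Or.inl hyU
    · right
      rwa [h.involutive y]
  · rintro (hx | hx)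
    · exact ⟨x, hx, rfl⟩
    · exact ⟨σ x, hx, h.apply_σ x⟩

/-- **`q` is an open map** when `σ` is continuous: the saturation `U ∪ σ ⁻¹' U` of an open set is
open, and `q` is a quotient map. [folklore] -/
theorem isOpenMap (h : IsBranchedDoubleQuotient σ q) (hσ : Continuous σ) : IsOpenMap q := by
  intro U hU
  rw [← h.isQuotientMap.isCoinducing.isOpen_preimage, h.preimage_image]
  exact hU.union (hU.preimage hσ)

/-- The image under `q` of an open set is open (`σ` continuous). [folklore] -/
theorem isOpen_image (h : IsBranchedDoubleQuotient σ q) (hσ : Continuous σ) {U : Set X}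
    (hU : IsOpen U) : IsOpen (q '' U) :=
  h.isOpenMap hσ U hU

/-- **The target of a branched double quotient of a compact space is compact** (`q` is a
continuous surjection). [folklore] -/
theorem compactSpace [CompactSpace X] (h : IsBranchedDoubleQuotient σ q) : CompactSpace Y := by
  rw [← isCompact_univ_iff, ← h.surjective.range_eq, ← image_univ]
  exact isCompact_univ.image h.continuous

omit [ChartedSpace (Fin 2 → ℂ) X] in
/-- The fixed-point set of `σ` is closed when `X` is Hausdorff and `σ` is continuous. [folklore] -/
theorem isClosed_fixedPoints [T2Space X] (hσ : Continuous σ) :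
    IsClosed (fixedPoints σ) :=
  isClosed_eq hσ continuous_id

/-- **The branch locus `q '' Fix σ` is compact** (for `X` compact Hausdorff, `σ` continuous).
[folklore] -/
theorem isCompact_image_fixedPoints [T2Space X] [CompactSpace X] (h : IsBranchedDoubleQuotient σ q)
    (hσ : Continuous σ) : IsCompact (q '' fixedPoints σ) :=
  ((isClosed_fixedPoints hσ).isCompact).image h.continuous

/-- The branch locus is closed (for `X` compact Hausdorff, `Y` Hausdorff, `σ` continuous).
[folklore] -/
theorem isClosed_image_fixedPoints [T2Space X] [CompactSpace X] [T2Space Y]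
    (h : IsBranchedDoubleQuotient σ q) (hσ : Continuous σ) : IsClosed (q '' fixedPoints σ) :=
  (h.isCompact_image_fixedPoints hσ).isClosed

/-- A point of `Y` lies on the branch locus iff SOME (equivalently every) point over it is fixed:
`q x ∈ q '' Fix σ ↔ σ x = x`. [folklore] -/
theorem apply_mem_image_fixedPoints_iff (h : IsBranchedDoubleQuotient σ q) (x : X) :
    q x ∈ q '' fixedPoints σ ↔ σ x = x := by
  constructor
  · rintro ⟨y, hy, hyx⟩
    rw [mem_fixedPoints_iff] at hy
    rcases (h.apply_eq_iff y x).1 hyx with rfl | rfl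
    · exact hy
    · rw [hy, hy]
  · intro hx
    exact ⟨x, hx, rfl⟩

/-- Off the branch locus `q` is a `C^∞` local diffeomorphism (restatement of the field
`isLocalDiffeomorphAt` through `apply_mem_image_fixedPoints_iff`). [folklore] -/
theorem isLocalDiffeomorphAt_of_notMem (h : IsBranchedDoubleQuotient σ q) {x : X}
    (hx : q x ∉ q '' fixedPoints σ) : IsLocalDiffeomorphAt 𝓘(ℝ, Fin 2 → ℂ) (𝓡 4) ∞ q x :=
  h.isLocalDiffeomorphAt x fun hfix => hx ((h.apply_mem_image_fixedPoints_iff x).2 hfix)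

/-! ### The comparison map of two branched double quotients by the same involution -/

variable {Y' : Type*} [TopologicalSpace Y'] [ChartedSpace (EuclideanSpace ℝ (Fin 4)) Y']
  {q' : X → Y'}

/-- **The comparison map** `Y → Y'` of two branched double quotients `q : X → Y`, `q' : X → Y'`
of `X` by the same involution `σ`: `y ↦ q' x` for any `x` over `y` (well defined since both maps
have the `σ`-orbits as fibres; `comparison_apply`). It is the canonical homeomorphism
`X/σ ≅ Y ≅ Y'`; it is smooth off the branch locus but in general not at branch points.
[folklore] -/
def comparison (h : IsBranchedDoubleQuotient σ q) (_h' : IsBranchedDoubleQuotient σ q') (y : Y) :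
    Y' :=
  q' (surjInv h.surjective y)

/-- **The comparison map is the unique factorisation `q' = comparison ∘ q`.** [folklore] -/
@[simp]
theorem comparison_apply (h : IsBranchedDoubleQuotient σ q) (h' : IsBranchedDoubleQuotient σ q')
    (x : X) : comparison h h' (q x) = q' x := by
  unfold comparison
  have hx : q (surjInv h.surjective (q x)) = q x := surjInv_eq h.surjective (q x)
  rcases (h.apply_eq_iff (surjInv h.surjective (q x)) x).1 hx with e | e
  · -- `x = surjInv …`
    exact congrArg q' e.symm
  · -- `x = σ (surjInv …)`
    exact (h'.apply_σ _).symm.trans (congrArg q' e.symm)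

/-- `comparison ∘ q = q'`. [folklore] -/
theorem comparison_comp (h : IsBranchedDoubleQuotient σ q) (h' : IsBranchedDoubleQuotient σ q') :
    comparison h h' ∘ q = q' :=
  funext (comparison_apply h h')

/-- The two comparison maps are mutually inverse. [folklore] -/
@[simp]
theorem comparison_comparison (h : IsBranchedDoubleQuotient σ q)
    (h' : IsBranchedDoubleQuotient σ q') (y : Y) : comparison h' h (comparison h h' y) = y := by
  obtain ⟨x, rfl⟩ := h.surjective y
  rw [comparison_apply, comparison_apply]

/-- **The comparison map is continuous** (`q` is a quotient map and `comparison ∘ q = q'` is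
continuous). [folklore] -/
theorem continuous_comparison (h : IsBranchedDoubleQuotient σ q)
    (h' : IsBranchedDoubleQuotient σ q') : Continuous (comparison h h') := by
  rw [h.isQuotientMap.continuous_iff, comparison_comp]
  exact h'.continuous

/-- **The comparison homeomorphism** `Y ≃ₜ Y'` of two branched double quotients of `X` by the
same involution. [folklore] -/
def comparisonHomeomorph (h : IsBranchedDoubleQuotient σ q) (h' : IsBranchedDoubleQuotient σ q') :
    Y ≃ₜ Y' where
  toFun := comparison h h'
  invFun := comparison h' h
  left_inv := comparison_comparison h h'
  right_inv := comparison_comparison h' h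
  continuous_toFun := continuous_comparison h h'
  continuous_invFun := continuous_comparison h' h

/-- The comparison homeomorphism is the comparison map. [folklore] -/
@[simp]
theorem coe_comparisonHomeomorph (h : IsBranchedDoubleQuotient σ q)
    (h' : IsBranchedDoubleQuotient σ q') : ⇑(comparisonHomeomorph h h') = comparison h h' :=
  rfl

/-- The comparison map is a bijection. [folklore] -/
theorem bijective_comparison (h : IsBranchedDoubleQuotient σ q)
    (h' : IsBranchedDoubleQuotient σ q') : Bijective (comparison h h') :=
  (comparisonHomeomorph h h').bijective

/-- The comparison map carries the branch locus of `q` onto that of `q'`. [folklore] -/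
theorem comparison_image_branchLocus (h : IsBranchedDoubleQuotient σ q)
    (h' : IsBranchedDoubleQuotient σ q') :
    comparison h h' '' (q '' fixedPoints σ) = q' '' fixedPoints σ := by
  rw [image_image]
  simp only [comparison_apply]

/-- A point is sent to the branch locus of `q'` iff it lies on the branch locus of `q`.
[folklore] -/
theorem comparison_mem_image_fixedPoints_iff (h : IsBranchedDoubleQuotient σ q)
    (h' : IsBranchedDoubleQuotient σ q') (y : Y) :
    comparison h h' y ∈ q' '' fixedPoints σ ↔ y ∈ q '' fixedPoints σ := by
  obtain ⟨x, rfl⟩ := h.surjective y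
  rw [comparison_apply, h'.apply_mem_image_fixedPoints_iff, h.apply_mem_image_fixedPoints_iff]

/-- **Off the branch locus the comparison map is `q' ∘ (local inverse of q)`**: if `σ x ≠ x` and
`s` is the `C^∞` local inverse of `q` at `x`, then `comparison h h' = q' ∘ s` near `q x`.
[folklore] -/
theorem comparison_eventuallyEq (h : IsBranchedDoubleQuotient σ q) (h' : IsBranchedDoubleQuotient σ q')
    {x : X} (hx : σ x ≠ x) :
    comparison h h' =ᶠ[𝓝 (q x)] q' ∘ (h.isLocalDiffeomorphAt x hx).localInverse := by
  have hD := h.isLocalDiffeomorphAt x hx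
  filter_upwards [hD.localInverse.open_source.mem_nhds hD.localInverse_mem_source] with y hy
  have hqy : q (hD.localInverse y) = y := hD.localInverse_right_inv hy
  conv_lhs => rw [← hqy]
  rw [comparison_apply]
  rfl

/-- **The comparison map is `C^∞` at the image of every non-fixed point.** [folklore] -/
theorem contMDiffAt_comparison (h : IsBranchedDoubleQuotient σ q) (h' : IsBranchedDoubleQuotient σ q')
    {x : X} (hx : σ x ≠ x) : ContMDiffAt (𝓡 4) (𝓡 4) ∞ (comparison h h') (q x) := by
  have hD := h.isLocalDiffeomorphAt x hx
  refine ContMDiffAt.congr_of_eventuallyEq ?_ (comparison_eventuallyEq h h' hx)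
  have hs : ContMDiffAt (𝓡 4) 𝓘(ℝ, Fin 2 → ℂ) ∞ hD.localInverse (q x) :=
    hD.localInverse_contMDiffAt
  have hq' : ContMDiffAt 𝓘(ℝ, Fin 2 → ℂ) (𝓡 4) ∞ q' (hD.localInverse (q x)) :=
    h'.contMDiff.contMDiffAt
  exact hq'.comp (q x) hs

/-- **The comparison map is a `C^∞` local diffeomorphism at the image of every non-fixed point**
(it is `q' ∘ s` there, a composition of local diffeomorphisms). [folklore] -/
theorem isLocalDiffeomorphAt_comparison (h : IsBranchedDoubleQuotient σ q)
    (h' : IsBranchedDoubleQuotient σ q') {x : X} (hx : σ x ≠ x) :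
    IsLocalDiffeomorphAt (𝓡 4) (𝓡 4) ∞ (comparison h h') (q x) := by
  have hD := h.isLocalDiffeomorphAt x hx
  have hD' := h'.isLocalDiffeomorphAt x hx
  have hx' : hD.localInverse (q x) = x := hD.localInverse_left_inv hD.localInverse_mem_target
  have hD'' : IsLocalDiffeomorphAt 𝓘(ℝ, Fin 2 → ℂ) (𝓡 4) ∞ q' (hD.localInverse (q x)) := by
    rw [hx']
    exact hD'
  have hcomp : IsLocalDiffeomorphAt (𝓡 4) (𝓡 4) ∞ (q' ∘ hD.localInverse) (q x) :=
    hD.localInverse_isLocalDiffeomorphAt.comp (K := 𝓡 4) (P := Y') hD''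
  exact hcomp.congr_of_eventuallyEq (comparison_eventuallyEq h h' hx)

/-- **The comparison map is `C^∞` on the complement of the branch locus.** [folklore] -/
theorem contMDiffOn_comparison (h : IsBranchedDoubleQuotient σ q)
    (h' : IsBranchedDoubleQuotient σ q') :
    ContMDiffOn (𝓡 4) (𝓡 4) ∞ (comparison h h') (q '' fixedPoints σ)ᶜ := by
  intro y hy
  obtain ⟨x, rfl⟩ := h.surjective y
  have hx : σ x ≠ x := fun hfix => hy ⟨x, hfix, rfl⟩
  exact (contMDiffAt_comparison h h' hx).contMDiffWithinAt

/-- **The comparison map is a `C^∞` local diffeomorphism on the complement of the branch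
locus.** [folklore] -/
theorem isLocalDiffeomorphOn_comparison (h : IsBranchedDoubleQuotient σ q)
    (h' : IsBranchedDoubleQuotient σ q') :
    IsLocalDiffeomorphOn (𝓡 4) (𝓡 4) ∞ (comparison h h') (q '' fixedPoints σ)ᶜ := by
  rintro ⟨y, hy⟩
  obtain ⟨x, rfl⟩ := h.surjective y
  have hx : σ x ≠ x := fun hfix => hy ⟨x, hfix, rfl⟩
  exact isLocalDiffeomorphAt_comparison h h' hx

end IsBranchedDoubleQuotient

end Literature.Topology.FourManifolds

end
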